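import Summits.QuantumFields.YangMills.Theorems.BalabanUVNodesN15CurvedLocalSpeciesOfReg335UN
import Literature.MathematicalPhysics.QuantumFieldTheory.Balaban1983to89.B9Eq335AxialCriterion
import HarnessLib

/-!
# Route «BalabanUVNodes» (cluster K4 «SpineRates»), Track-A DAG node N15 = NE2, BACKGROUND LAYER — THE PRODUCTION SIDE OF FILE 1 AT `G = U(n)`: a `U(n)` configuration on `ℤᵈ` with
# SMALL AND SLOWLY-VARYING PLAQUETTE VARIABLES (r06's two radii `α₀η²`, `c₀η³`) is in print's class (3.35) on every cube of `ℓ¹`-radius `M·Lʲ` (r06 `reg335Zd_of_plaq_radii`, complete axial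
# gauge) and therefore carries there a UNITARY gauge with BOTH bond letters of FILE 1 — the completion of g5 FILES 3∕4's first-letter-only junction, by name

Cell `pub-ymgap`, seat `pub-ymgap-dag-n15-w2` (WIDTH SEAT 2∕3 on node N15, director-ym №197 ∕ HUMAN RULING D-0149), g6, third piece (bus CLAIM-3).  `bears_on: R4∕N15 · K3⁸
SpineGivenEndpointR13SepCoPHV (stmt-QuantumFields-27366)`.  Filed `--kind proof --supports stmt-QuantumFields-27366 --as helper` — COUNT-NEUTRAL.  Theorems only; 0 `def`, 0 `sorry`.
Imports BY NAME this seat's g6 FILE 1 `…CurvedLocalSpeciesOfReg335UN` (`uN_exists_gauge_opLetters_of_reg335Cube`, `uN_val_gaugeTr_eq`, `uN_val_inv_eq_conjTranspose`) and lit-balaban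
r06's `B9Eq335AxialCriterion` (★ `reg335Zd_of_plaq_radii`; through it `B8Eq133Hypotheses.Reg335Zd`∕`shiftT`∕`byDir`, `B7Prop1Explicit.Site`∕`hol`∕`plaqWord`∕`l1`∕`U1`); nothing in the
tree is modified, no landed name re-declared.

WHY.  g5 FILES 3∕4 produced the FIRST (3.35) letter for a plaquette-small `U(N)` box through pub-balaban's axial gauge and left the second DISPLAYED; FILE 1 of this generation
discharged both letters FROM THE CLASS (3.35) BY NAME, the class remaining the hypothesis.  The tree also HOLDS an elementary PRODUCER of the class: lit-balaban r06's
`B9Eq335AxialCriterion.reg335Zd_of_plaq_radii` — *«a `U1`-valued configuration whose plaquette variables are within `α₀η²` of `1` AND whose transported plaquette differences are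
`≤ c₀η³` satisfies (3.35) (`B8Eq133Hypotheses.Reg335Zd`) on EVERY family of sets of `ℓ¹`-radius `≤ M·Lʲ` at scales `Lʲη ≤ 1`, with `O(1)Mα₀ := 2(M+1)α₀ + 2Mc₀ + 4M(1+2M)α₀²`, IN
THE COMPLETE AXIAL GAUGE»* (NOT print's derivation: [Balaban1985RegularSpaces] p. 99 uses its Theorem 4; an elementary sufficient criterion under the extra gradient radius `c₀η³`).
THIS FILE composes the two at `𝔸 = M_n(ℂ)` with the operator norm:
* `uN_mem_U1_of_mem_unitaryGroup` — a `U(n)`-valued configuration is `U1`-valued (the criterion's only structural hypothesis);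
* ★★ `uN_exists_gauge_opLetters_of_plaq_radii` — `U(n)`-valued `V` on `ℤᵈ` with the two radii, `0 < η ≤ 1`, `L ≥ 1`, `(M+1)α₀ ≤ ½`, a set `Q` inside an `ℓ¹`-ball of radius `M·Lʲ`,
  `ξ = Lʲη ≤ 1`, any `C > 2(M+1)α₀ + 2Mc₀ + 4M(1+2M)α₀²` ⟹ ∃ `u`, UNITARY on `Q`, with `‖u(z)V(z,κ)u(z+e_κ)⁻¹ − 1‖_{op} ≤ η·(C∕ξ)e^{ηC∕ξ}` (`z ∈ Q`) and
  `‖V^u(z+e_κ, ν) − V^u(z, ν)‖_{op} ≤ η²·(C∕ξ²)e^{ηC∕ξ}` (`z, z+e_κ ∈ Q`, ALL `κ, ν`) — the criterion on the one-cube family `{(Q, j)}`, then FILE 1 §2;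
* ★ `uN_exists_gauge_firstLetter_conj_of_plaq_radii` — the first letter in the `…SpeciesUN` currency `u(z)V(z,κ)u(z+e_κ)ᴴ` on bonds with both ends in `Q`.
So the ENTRANCE of the per-cube road (FILE 1 ∕ g5 FILE 11) is reached from GAUGE-INVARIANT smallness data of the field alone — small curvature AND small covariant variation of the
curvature —, entirely by name; in particular the class (3.35) at `G = U(n)` is inhabited by genuinely curved configurations, not only by the pure gauges of FILE 1 §4.

HONEST FRAMING ∕ LIMITS.  Composition of two tree theorems; `ℤᵈ` carrier (`B7Prop1Explicit.Site d = ℤᵈ`; the cube device's finite tori receive (3.35) cube-wise through the lift ∕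
descent dictionaries of the tree, e.g. `UnitScaleTiltProp7SectET3ClassTransfer.reg335Cube_torus_of_pull` — not re-typed here); constants crude and r06's; the gradient radius `c₀η³` is an
EXTRA hypothesis relative to print's (1.33); nothing of [B5]∕[B6]∕[B8]∕[B9] asserted beyond cited shapes; NE2⁺ NOT PRINTED ∕ NOT proved; N15 NOT discharged; K3⁸ OPEN, skeleton v6 untouched
(0∕2); counts of record UNMOVED (typed 28∕28 · discharged 5∕27 · A 5∕28); NOT ℝ⁴ ∕ OS ∕ mass gap ∕ Clay; R4 closes the conditional finite-𝕋⁴ rung `BalabanLadder.UV` only.  Restate-immune.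
-/

set_option autoImplicit false

noncomputable section
open scoped BigOperators Matrix

namespace Summit.QuantumFields.YangMills.BalabanUVNodes.N15.CurvedSpecies

section PlaqRadii

open scoped Matrix.Norms.L2Operator
open Literature.MathematicalPhysics.QuantumFieldTheory.Balaban1983to89
open Literature.MathematicalPhysics.QuantumFieldTheory.Balaban1983to89.B7Prop1Explicit (Site e hol plaqWord l1 U1)
open Literature.MathematicalPhysics.QuantumFieldTheory.Balaban1983to89.B8Eq133Hypotheses (Reg335Zd shiftT byDir)
open Literature.MathematicalPhysics.QuantumFieldTheory.Balaban1983to89.B9Eq3117Current (gaugeTr)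
open Literature.MathematicalPhysics.QuantumFieldTheory.Balaban1983to89.B9Eq335RegularityClasses (Reg335Cube)
open Literature.MathematicalPhysics.QuantumFieldTheory.Balaban1983to89.B9Eq335AxialCriterion (reg335Zd_of_plaq_radii)
open Literature.MathematicalPhysics.QuantumFieldTheory.Balaban1983to89.LatticeNorms (scaleLen)

variable {n : Type} [Fintype n] [DecidableEq n] [Nonempty n] {d : ℕ}

/-- A `U(n)`-valued configuration on `ℤᵈ` is `U1`-valued for the operator norm (`‖u‖ = ‖u⁻¹‖ = 1`). [cite: Balaban1985Averaging, (19) p.21] -/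
theorem uN_mem_U1_of_mem_unitaryGroup {V : Site d → Fin d → (Matrix n n ℂ)ˣ} (hV : ∀ x κ, (V x κ : Matrix n n ℂ) ∈ Matrix.unitaryGroup n ℂ) (x : Site d) (κ : Fin d) :
    V x κ ∈ U1 (Matrix n n ℂ) := by
  rw [B7Prop1Explicit.mem_U1, uN_val_inv_eq_conjTranspose (hV x κ)]
  exact ⟨(CStarRing.norm_of_mem_unitary (hV x κ)).le, (CStarRing.norm_of_mem_unitary (Unitary.star_mem (hV x κ))).le⟩

/-- ★★ **(3.35) PRODUCED ON A CUBE FROM THE TWO PLAQUETTE RADII (r06's axial criterion) ⟹ A UNITARY GAUGE WITH BOTH LETTERS, `G = U(n)`.**  A `U(n)`-valued configuration `V` on `ℤᵈ`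
whose plaquette variables are within `α₀η²` of `1` (`h44`) and whose transported plaquette differences are `≤ c₀η³` (`hG`), `0 < η ≤ 1`, `L ≥ 1`, `(M + 1)α₀ ≤ ½`; a set `Q ⊂ ℤᵈ` inside an
`ℓ¹`-ball of radius `M·Lʲ` at a scale `ξ = Lʲη ≤ 1`; any `C > 2(M+1)α₀ + 2Mc₀ + 4M(1+2M)α₀²` ⟹ there is a gauge `u`, UNITARY on `Q`, with, in the operator norm,
`‖u(z)V(z, κ)u(z + e_κ)⁻¹ − 1‖ ≤ η·(C∕ξ)e^{ηC∕ξ}` for `z ∈ Q` and `‖V^u(z + e_κ, ν) − V^u(z, ν)‖ ≤ η²·(C∕ξ²)e^{ηC∕ξ}` for `z, z + e_κ ∈ Q`, all `κ, ν` — r06's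
`B9Eq335AxialCriterion.reg335Zd_of_plaq_radii` (the class (3.35) in the complete axial gauge, `U1`-valued fields) BY NAME on the one-cube family `{(Q, j)}`, then FILE 1's
`uN_exists_gauge_opLetters_of_reg335Cube`.  NOT print's derivation of (3.35) ([B8] p. 99 uses Theorem 4); an elementary sufficient criterion under the extra gradient radius, as r06 says.
[cite: Balaban1985BackgroundPropagators, (3.35) p.396, (3.28) p.395; Balaban1985RegularSpaces, (1.33) p.82, p.99; Balaban1985Averaging, pp.24–25] -/
theorem uN_exists_gauge_opLetters_of_plaq_radii (V : Site d → Fin d → (Matrix n n ℂ)ˣ) (hV : ∀ x κ, (V x κ : Matrix n n ℂ) ∈ Matrix.unitaryGroup n ℂ)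
    {η : ℝ} (hη : 0 < η) (hη1 : η ≤ 1) {L : ℕ} (hL : 1 ≤ L) {α₀ c₀ M : ℝ} (hα₀ : 0 ≤ α₀) (hc₀ : 0 ≤ c₀) (hM : 0 ≤ M) (hsmall : (M + 1) * α₀ ≤ 1 / 2)
    (h44 : ∀ (x : Site d) (κ μ : Fin d), κ ≠ μ → ‖((hol V x (plaqWord κ μ) : (Matrix n n ℂ)ˣ) : Matrix n n ℂ) - 1‖ ≤ α₀ * η ^ 2)
    (hG : ∀ (p : Site d) (ν κ μ : Fin d), κ ≠ μ →
      ‖(V p ν : Matrix n n ℂ) * ((hol V (p + e ν) (plaqWord κ μ) : (Matrix n n ℂ)ˣ) : Matrix n n ℂ) * (((V p ν)⁻¹ : (Matrix n n ℂ)ˣ) : Matrix n n ℂ) -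
          ((hol V p (plaqWord κ μ) : (Matrix n n ℂ)ˣ) : Matrix n n ℂ)‖ ≤ c₀ * η ^ 3)
    {Q : Set (Site d)} {j : ℕ} (hQ1 : (L : ℝ) ^ j * η ≤ 1) (hQ : ∃ y : Site d, ∀ z ∈ Q, (l1 (z - y) : ℝ) ≤ M * (L : ℝ) ^ j)
    {C : ℝ} (hC : 2 * (M + 1) * α₀ + 2 * M * c₀ + 4 * M * (1 + 2 * M) * α₀ ^ 2 < C) :
    ∃ u : Site d → (Matrix n n ℂ)ˣ, (∀ z ∈ Q, (u z : Matrix n n ℂ) ∈ Matrix.unitaryGroup n ℂ) ∧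
      (∀ κ, ∀ z ∈ Q, ‖(gaugeTr (shiftT d) u (byDir V) κ z : Matrix n n ℂ) - 1‖ ≤
        η * (C / scaleLen (L : ℝ) η j) * Real.exp (η * (C / scaleLen (L : ℝ) η j))) ∧
      (∀ κ ν, ∀ z ∈ Q, shiftT d κ z ∈ Q →
        ‖(gaugeTr (shiftT d) u (byDir V) ν (shiftT d κ z) : Matrix n n ℂ) - gaugeTr (shiftT d) u (byDir V) ν z‖ ≤
          η ^ 2 * (C / scaleLen (L : ℝ) η j ^ 2) * Real.exp (η * (C / scaleLen (L : ℝ) η j))) := by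
  have hV1 : ∀ x κ, V x κ ∈ U1 (Matrix n n ℂ) := uN_mem_U1_of_mem_unitaryGroup hV
  have hR : Reg335Zd η L {(Q, j)} C V :=
    reg335Zd_of_plaq_radii hV1 hη hη1 hL hα₀ hc₀ hM hsmall h44 hG (𝒬 := {(Q, j)}) (fun q hq => by
      rcases Set.mem_singleton_iff.mp hq with rfl
      exact ⟨hQ1, hQ⟩) hC
  have hcube : Reg335Cube (shiftT d) (byDir V) η Q (scaleLen (L : ℝ) η j) C := hR (Q, j) (Set.mem_singleton _)
  exact uN_exists_gauge_opLetters_of_reg335Cube (T := shiftT d) (byDir V) hη hcube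

/-- ★ **THE SAME IN THE `…SpeciesUN` CURRENCY ON INTERIOR BONDS**: under the hypotheses of `uN_exists_gauge_opLetters_of_plaq_radii`, with the gauge `u` unitary on `Q`, for a bond
`(z, z + e_κ)` with BOTH ends in `Q` the transformed bond variable reads `V^u(z, κ) = u(z)V(z, κ)u(z + e_κ)ᴴ` and `‖u(z)V(z, κ)u(z + e_κ)ᴴ − 1‖ ≤ η·(C∕ξ)e^{ηC∕ξ}`.
[cite: Balaban1985BackgroundPropagators, (3.35) p.396, (3.28) p.395] -/
theorem uN_exists_gauge_firstLetter_conj_of_plaq_radii (V : Site d → Fin d → (Matrix n n ℂ)ˣ) (hV : ∀ x κ, (V x κ : Matrix n n ℂ) ∈ Matrix.unitaryGroup n ℂ)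
    {η : ℝ} (hη : 0 < η) (hη1 : η ≤ 1) {L : ℕ} (hL : 1 ≤ L) {α₀ c₀ M : ℝ} (hα₀ : 0 ≤ α₀) (hc₀ : 0 ≤ c₀) (hM : 0 ≤ M) (hsmall : (M + 1) * α₀ ≤ 1 / 2)
    (h44 : ∀ (x : Site d) (κ μ : Fin d), κ ≠ μ → ‖((hol V x (plaqWord κ μ) : (Matrix n n ℂ)ˣ) : Matrix n n ℂ) - 1‖ ≤ α₀ * η ^ 2)
    (hG : ∀ (p : Site d) (ν κ μ : Fin d), κ ≠ μ →
      ‖(V p ν : Matrix n n ℂ) * ((hol V (p + e ν) (plaqWord κ μ) : (Matrix n n ℂ)ˣ) : Matrix n n ℂ) * (((V p ν)⁻¹ : (Matrix n n ℂ)ˣ) : Matrix n n ℂ) -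
          ((hol V p (plaqWord κ μ) : (Matrix n n ℂ)ˣ) : Matrix n n ℂ)‖ ≤ c₀ * η ^ 3)
    {Q : Set (Site d)} {j : ℕ} (hQ1 : (L : ℝ) ^ j * η ≤ 1) (hQ : ∃ y : Site d, ∀ z ∈ Q, (l1 (z - y) : ℝ) ≤ M * (L : ℝ) ^ j)
    {C : ℝ} (hC : 2 * (M + 1) * α₀ + 2 * M * c₀ + 4 * M * (1 + 2 * M) * α₀ ^ 2 < C) :
    ∃ u : Site d → (Matrix n n ℂ)ˣ, (∀ z ∈ Q, (u z : Matrix n n ℂ) ∈ Matrix.unitaryGroup n ℂ) ∧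
      ∀ κ, ∀ z ∈ Q, shiftT d κ z ∈ Q →
        ‖(u z : Matrix n n ℂ) * (V z κ : Matrix n n ℂ) * ((u (shiftT d κ z) : Matrix n n ℂ))ᴴ - 1‖ ≤
          η * (C / scaleLen (L : ℝ) η j) * Real.exp (η * (C / scaleLen (L : ℝ) η j)) := by
  obtain ⟨u, hu, h1, -⟩ := uN_exists_gauge_opLetters_of_plaq_radii V hV hη hη1 hL hα₀ hc₀ hM hsmall h44 hG hQ1 hQ hC
  refine ⟨u, hu, fun κ z hz hz' => ?_⟩
  have h := h1 κ z hz
  rwa [uN_val_gaugeTr_eq (T := shiftT d) (byDir V) (hu _ hz')] at h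

end PlaqRadii

end Summit.QuantumFields.YangMills.BalabanUVNodes.N15.CurvedSpecies

end
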